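import Literature.MathematicalPhysics.QuantumFieldTheory.Balaban1983to89.B2Eq218Translation

/-!
# `Balaban1983to89.B2Eq224FirstStepFields` — [Balaban1982Higgs2] (2.23), (2.24), (2.26)–(2.27) pp. 561–563: the scalar-field
translation `φ = φ′ + aL⁻²C^{(0)}_{Λ₃}Q*ψ` (2.23), the configuration `B^{(1)} = aL⁻²ζC^{(0)}Q*B` (2.24), the localized
block-field form `Δ^{(k+1),L}_Λ(Ω,A)` (2.27) — DEFINITIONS WITH BODIES in matrix coordinates — and the quadratic-form lines
of the inequality (2.26) PROVED as the exact completing-of-the-square identity behind a localized translation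

statement-level skeleton of published theorems with citation tags; proofs where landed; nothing here is a claim about the Yang–Mills mass gap

CITATION HEADER.  T. Bałaban, *(Higgs)₂,₃ quantum fields in a finite volume. II. An upper bound*, Commun. Math. Phys.
**86** (1982) 555–594, doi:10.1007/bf01214890 [Balaban1982Higgs2] (cell paper B2; PDF held
`paper:balaban1982-cmp86-higgs23-ii`, journal page = PDF page + 554; pp. 561–563 READ AS IMAGES on the ×2 renders
`run/shared/lean/pub/pub-balaban/b2b-balaban-ref1/pages/1982-cmp86-higgs23-II/1982-cmp86-higgs23-II-p007-x2.png`,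
`…-p008-x2.png`), and part I: T. Bałaban, *(Higgs)₂,₃ quantum fields in a finite volume. I. A lower bound*, Commun. Math.
Phys. **85** (1982) 603–636 [Balaban1982Higgs1], p. 611 render `…/1982-cmp85-higgs23-I/1982-cmp85-higgs23-I-p009-x2.png`
((2.31)–(2.32), the conditioned covariances), p. 614 ((3.10)–(3.11), typed `…B1Sect3Statements.transl310`/`Split311`).
Unit `lit-balaban-r02` gen 3 (reader/typer, B2 fold owner; HOME `run/shared/lean/pub/lit-balaban/`).  SKELETON row
**B2.Eq2.42** ((2.20)–(2.42), head `absent`; members landed so far: (2.20)–(2.21) `…B2Eq220CovDerivSplit`, (2.29)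
`…B2Eq228Conditioning` (p15), the split (2.18)–(2.19) `…B2Eq218Translation` (r02) whose dictionary this file continues).

WHAT IS PRINTED (verbatim).  p. 561 [PDF 7]: *"We make a next transformation of the integral, namely we make the
translation  φ = φ′ + aL⁻²C^{(0)}_{Λ₃}(B̃^{(1)})Q*(B̃^{(1)})ψ. (2.23)  This translation changes the interaction, and we get an
expression almost identical to V^{(0)} in Chap. I.3, only with the modified propagators for the scalar field and the
summations with respect to variables in the vertices restricted to the set Λ₇. We will change slightly this expression. Let
us introduce a configuration B^{(1)} by the formula"*  p. 562 [PDF 8]: *"B^{(1)} = aL⁻²ζC^{(0)}Q*B, (2.24)  and let us notice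
that Lemma 2.3 implies also (∂_μB^{(1)})(x) = O(p(ε)) for x ∈ Λ₂, μ = 1, …, d. Hence the assumptions of Proposition I.2 are
satisfied for B^{(1)} on Λ₂, and we have  aL⁻²(C^{(0)}_{Λ₃}(B̃^{(1)})Q*(B̃^{(1)})ψ)(x) = aL⁻²(G₁(Λ₂, B^{(1)})Q*(B^{(1)})Λ₆ψ)(x)
+ O(ε^κ) =: ψ^{(1)}(x) + O(ε^κ), κ > d, x ∈ Λ₇. (2.25) … As an effect of the considerations of this point, we get the
inequality  (2.1) ≦ Σ_{Λ₀}∫dA′∫dφ′ ζ_{Λ₀}χ_{Λ₋₁}χ′χ₁ · exp[−½aL^{d−2} Σ_{y∈T′₁} |(Λ₀′ᶜB)(y) − (QA′)(y)|²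
− ½⟨A′, (−Δ + μ₀²ε²)A′⟩ + aL⁻² Σ_{b∈st(Λ₀)} A′(b₊)·(C^{(0)}_{Λ₀}Q*B)(b₋) − ½⟨B, Δ^{(1),L}_{Λ₀}B⟩
− ½aL^{d−2} Σ_{y∈T′₁} |(Λ₃′ᶜψ)(y) − (Q(B̃^{(1)})φ′)(y)|² − ½⟨φ′, (−Δ_{B̃^{(1)}} + m²ε²)φ′⟩
+ aL⁻² Σ_{b∈st(Λ₃)} φ′(b₊)·U(B̃^{(1)}_b)(C^{(0)}_{Λ₃}(B^{(1)})Q*(B^{(1)})ψ)(b₋) − ½⟨ψ, Δ^{(1),L}_{Λ₃}(B^{(1)})ψ⟩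
+ V^{(0)}(Λ₇, B^{(1)}, ψ, A′, φ′) + O(ε^{κ₀})|Λ₇ᶜ| + O(ε^κ)|T₁|], (2.26)  where the new quadratic form Δ^{(1),L}_{Λ₃}(B^{(1)})
for the field ψ is defined by the general formula  ⟨ψ, Δ^{(k+1),L}_Λ(Ω, A)ψ⟩ = aL^{d−2} Σ_{y∈Λ′} |ψ(y)|²
− a²L⁻⁴⟨ψ, Q(A)C^{(k)}_Λ(Ω, A)Q*(A)ψ⟩,  Λ ⊂ Ω^{(k)}, (2.27)  and the similar formula holds for the vector field."*
Part I, p. 611 [PDF 9]: *"In the sequel we will use the covariance rescaled to the unit lattice and it is of the form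
C^{(k)}(Ω, A) = (aL⁻²P(A) + Δ^{(k)}(Ω, A))⁻¹. (2.31) … Beside the covariances (2.31), we will need the covariances which are
obtained by conditioning with respect to some set Λ ⊂ Ω^{(k)}. For an operator A defined on configurations φ : Ω^{(k)} → R^N
we define A↾_Λ as an operator on configurations φ : Λ → R^N by the formula A↾_Λφ = ΛAΛφ. We will use the following
covariances also  C^{(k)}_Λ(Ω, A) = ((aL⁻²P(A) + Δ^{(k)}(Ω, A))↾_Λ)⁻¹. (2.32)  Here we will assume that the set Λ is a
union of big blocks of T₁^{(k)}."*; p. 560 [PDF 6] of part II: *"C^{(0)}_{Λ₀} denotes the covariance with the Dirichlet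
boundary conditions outside Λ₀ introduced in Chap. I.2"*; the one-pair Gaussian exponent of (2.1) p. 556 / (I.3.7) p. 613:
*"−½aL^{d−2} Σ_{y∈T′₁} |ψ(y) − (Q(A)φ)(y)|² − ½⟨φ, (−Δ_A + m²ε²)φ⟩"*.

DICTIONARY (the matrix coordinates of `…B2Eq218Translation`, `…B2Sect3AGaussianStep`, `…B1Eq314Proof.split311_matrix`).
`X` ↤ the components of the unit-lattice fields on `T₁` (site × internal index; for the vector field: bonds), `Y` ↤ the
components of the block fields on `T′₁`; real coordinates.  `Q : Matrix Y X ℝ` ↤ the (covariant) averaging `Q(A)` (for the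
vector field the plain `Q`), `Qs : Matrix X Y ℝ` ↤ `Q*(A)`; the scalar products (I.1.5) after the rescaling to the unit
lattice carry the weight `1` on `T₁` and `w` ↤ `L^d` on `T′₁`, so `aL^{d−2}Σ_{y}|f(y)|² = c·w·Σ_y f(y)²` with `c` ↤ `aL⁻²`
(`coeff_cw`), `⟨ψ, Kψ⟩_{T′₁} = w·(ψ ⬝ᵥ K *ᵥ ψ)`, and the adjoint of `Q` is `Q* = w·Qᵀ` (hypothesis `hQs` where used;
for `U = 1` and `Q(y,x) = L^{−d}[x ∈ B(y)]` this is the kernel `qstar 1 blk` of `…B2Eq218Translation`).  `D : Matrix X X ℝ`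
↤ `−Δ_A + m²ε²` (resp. `−Δ + μ₀²ε²`), symmetric (`hD`); its off-diagonal entry `D x x′` for a bond `b = ⟨x′, x⟩` is
`−U(A_b)` (resp. `−1`), so `−D x x′` is the parallel transport in the boundary term of (2.26).  `kOp c Q Qs D =
c·Q*Q + D` ↤ `aL⁻²P(A) + Δ^{(k)}(Ω,A) = (C^{(k)})⁻¹` ((I.2.31), `P = Q*Q`).  `Λ : Finset X` ↤ a union of big blocks
(Λ₀ resp. Λ₃), `Λ' : Finset Y` ↤ its block set (the `Λ′` of (2.27); *"union of big blocks"* = hypothesis `hQ`: `Q y x ≠ 0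
→ (x ∈ Λ ↔ y ∈ Λ′)`).  `CΛ : Matrix X X ℝ` ↤ `C^{(k)}_Λ(Ω,A)` of (I.2.32), i.e. the inverse of the COMPRESSION `ΛKΛ` on
Λ-configurations, extended by `0` (hypotheses `hCs`: supported in `Λ × Λ`, `hC`: `(K·CΛ)(x,x′) = δ_{xx′}` for
`x, x′ ∈ Λ`).  `(Λ′ᶜψ)` = `ψ − restrict Λ′ ψ` (`…B2Eq218Translation.restrict`); `st(Λ)` ↤ the pairs `(x ∉ Λ, x′ ∈ Λ)`
(only nearest neighbours contribute, through `D x x′`).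

WHAT THIS MODULE PROVIDES.  §1 (2.24) `bOne` (B^{(1)}) and its relation to the B̃^{(1)} of (2.19): `btilde_eq_transl218_bOne`
(`B̃^{(1)} = (1 − θ₁)·A + θ₁·B^{(1)}` with `A` the translated field (2.18)), `btilde_eq_bOne_of_theta_eq_one` (on Λ₂, where
θ₁ = 1, `B̃^{(1)} = B^{(1)}` — the fact behind *"the assumptions of Proposition I.2 are satisfied for B^{(1)} on Λ₂"*).
§2 (2.23) `transl223` (`transl223_eq_transl310`: it IS part I's (3.10)/(3.18) shape `…B1Sect3Statements.transl310` with the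
conditioned covariance; `transl223_qstar`: with the plain `Q*` it is literally the vector-field translation (2.18)
`…B2Eq218Translation.transl218` — *"the similar formula holds for the vector field"*).  §3 (2.27) `delta227` (the operator
`aL⁻²χ_{Λ′} − a²L⁻⁴Q(A)C^{(k)}_Λ(Ω,A)Q*(A)`) with **`form227`** = the display (2.27) verbatim for its form in `⟨·,·⟩_{T′₁}`;
`kOp` ((I.2.31)); `gaussForm` (the one-pair Gaussian exponent of (2.1)/(I.3.7)); `bdry226` (the boundary sum
`aL⁻²Σ_{b∈st(Λ)} φ′(b₊)·U(·)(C_ΛQ*ψ)(b₋)` of (2.26)).  §4 the identity: **`eq226_quadratic`** — for every `φ′, ψ`,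
`gaussForm (transl223 φ′ ψ) ψ = ½aL^{d−2}Σ_y |(Λ′ᶜψ)(y) − (Qφ′)(y)|² + ½⟨φ′, Dφ′⟩ − bdry226 + ½⟨ψ, Δ^{(k+1),L}_Λψ⟩`,
i.e. MINUS lines 1–2 (pair `A′, B`, `Λ = Λ₀`, `U = 1`) and MINUS lines 3–5 (pair `φ′, ψ`, `Λ = Λ₃`) of the exponent in
(2.26), from (2.18)/(2.23), (2.27) and (I.2.32) alone (`eq226_lines`: the same with the printed signs); the whole-lattice
case `eq226_quadratic_univ` is the first equality of (I.3.11)/(I.3.19) (no boundary term, no `Λ′ᶜψ`; cf. p14's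
`…B1Eq314Proof.split311_matrix`); `inv232_congr`: the hypotheses on `CΛ` see `K` only through its `Λ × Λ` block (why
(2.25)/(2.26) may write the Λ₃-localized covariance at `B^{(1)}`: `B̃^{(1)} = B^{(1)}` on `Λ₂ ⊃ Λ₃`).
v1.1 (§5): `eq235` — the identity of §1 is the print's own **(2.35)** p. 564 (*"B̃^{(1)} = (1 − θ₁)A + θ₁B^{(1)}"*, stated
there as the effect of the translations inverse to (2.18), (2.23)), now carrying that locator; `psiOne` — the field `ψ^{(1)}`
DEFINED in (2.25) (`psiOne_eq_transl223`: the shift part of the shape (2.23) with `G₁(Λ₂, B^{(1)})` and `Λ₆ψ`).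
HONEST SCOPE.  Not treated: the estimates (2.22)/(2.25) (`O(ε^{κ₀})`, `O(ε^κ)`, Proposition I.2, Lemma 2.3), the
interaction `V^{(0)}`, the characteristic functions `ζ_{Λ₀}χ_{Λ₋₁}χ′χ₁`, and the inequality sign of (2.26) — only the exact
Gaussian bookkeeping of its quadratic-form lines is certified; the operators `Q(A)`, `Δ_A`, `C^{(k)}_Λ` are data carrying the
printed structural facts as hypotheses (adjointness, symmetry, block structure, (I.2.32)), as in all B1/B2 schematic files.
No `Prop`-valued fact, no `sorry`; axioms standard.
-/

namespace Literature.MathematicalPhysics.QuantumFieldTheory.Balaban1983to89.B2Eq224FirstStepFields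

open Finset Matrix
open B2Eq218Translation (qstar zetaCQ transl218 btilde sub_restrict_apply)

variable {X Y : Type*}

/-! ## §0  The coefficients: `aL⁻²·L^d = aL^{d−2}` -/

/-- The dictionary of the coefficients in (2.26)–(2.27): with `c = aL⁻²` and the weight `w = L^d` of the block-lattice
scalar product, `c·w = aL^{d−2}` (`d ≥ 2`, `L ≠ 0`). [cite: Balaban1982Higgs2, (2.27) p.562] -/
theorem coeff_cw (a L : ℝ) (d : ℕ) (hd : 2 ≤ d) (hL : L ≠ 0) : a / L ^ 2 * L ^ d = a * L ^ (d - 2) := by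
  obtain ⟨k, rfl⟩ := Nat.exists_eq_add_of_le hd
  rw [Nat.add_sub_cancel_left, pow_add]
  field_simp

/-! ## §1  (2.24): the configuration `B^{(1)}` and the «large» field `B̃^{(1)}` of (2.19) -/

/-- **(2.24)** p. 562 [PDF 8], verbatim: *"B^{(1)} = aL⁻²ζC^{(0)}Q*B"* — with the p. 561 kernel `ζC^{(0)}Q*`
(`…B2Eq218Translation.zetaCQ`), `c` ↤ `aL⁻²`. [cite: Balaban1982Higgs2, (2.24) p.562] -/
def bOne [Fintype X] [Fintype Y] [DecidableEq Y] (c w : ℝ) (C : Matrix X X ℝ) (blk : X → Y) (ζ : Matrix X Y ℝ)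
    (B : Y → ℝ) : X → ℝ :=
  c • (zetaCQ ζ C w blk *ᵥ B)

/-- (2.24) at a point. [cite: Balaban1982Higgs2, (2.24) p.562] -/
theorem bOne_apply [Fintype X] [Fintype Y] [DecidableEq Y] (c w : ℝ) (C : Matrix X X ℝ) (blk : X → Y)
    (ζ : Matrix X Y ℝ) (B : Y → ℝ) (x : X) : bOne c w C blk ζ B x = c * (zetaCQ ζ C w blk *ᵥ B) x := rfl

/-- The «large» field of (2.19) in terms of (2.18) and (2.24): `B̃^{(1)} = (1 − θ₁)·A + θ₁·B^{(1)}` pointwise, `A` the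
translated field (2.18) (read off the bracket `[(1 − θ₁)(A′ + aL⁻²C^{(0)}_{Λ₀}Q*B) + θ₁aL⁻²ζC^{(0)}Q*B]` of (2.19)).
[cite: Balaban1982Higgs2, (2.19) p.560, (2.24) p.562] -/
theorem btilde_eq_transl218_bOne [Fintype X] [Fintype Y] [DecidableEq Y] (c w : ℝ) (CΛ C : Matrix X X ℝ)
    (blk : X → Y) (θ : X → ℝ) (ζ : Matrix X Y ℝ) (A' : X → ℝ) (B : Y → ℝ) (x : X) :
    btilde c w CΛ C blk θ ζ A' B x = (1 - θ x) * transl218 c w CΛ blk A' B x + θ x * bOne c w C blk ζ B x := by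
  simp only [btilde, transl218, bOne, Pi.add_apply, Pi.smul_apply, smul_eq_mul]

/-- On Λ₂, where `θ₁ = 1`, the «large» field IS the configuration (2.24): `B̃^{(1)}(x) = B^{(1)}(x)` — the fact behind
*"Hence the assumptions of Proposition I.2 are satisfied for B^{(1)} on Λ₂"* and the appearance of `B^{(1)}` inside the
Λ₃-localized objects of (2.25)–(2.26). [cite: Balaban1982Higgs2, (2.24)–(2.25) p.562] -/
theorem btilde_eq_bOne_of_theta_eq_one [Fintype X] [Fintype Y] [DecidableEq Y] {c w : ℝ} {CΛ C : Matrix X X ℝ}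
    {blk : X → Y} {θ : X → ℝ} {ζ : Matrix X Y ℝ} {A' : X → ℝ} {B : Y → ℝ} {x : X} (hx : θ x = 1) :
    btilde c w CΛ C blk θ ζ A' B x = bOne c w C blk ζ B x := by
  rw [btilde_eq_transl218_bOne, hx]; ring

/-! ## §2  (2.23): the translation of the scalar field -/

/-- **(2.23)** p. 561 [PDF 7], verbatim: *"φ = φ′ + aL⁻²C^{(0)}_{Λ₃}(B̃^{(1)})Q*(B̃^{(1)})ψ"* — `c` ↤ `aL⁻²`, `CΛ` ↤ the
conditioned covariance `C^{(0)}_{Λ₃}(B̃^{(1)})` ((I.2.32), a `Λ₃ × Λ₃` kernel extended by `0`), `Qs` ↤ `Q*(B̃^{(1)})`.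
[cite: Balaban1982Higgs2, (2.23) p.561] -/
def transl223 [Fintype X] [Fintype Y] (c : ℝ) (CΛ : Matrix X X ℝ) (Qs : Matrix X Y ℝ) (φ' : X → ℝ) (ψ : Y → ℝ) :
    X → ℝ :=
  φ' + c • (CΛ *ᵥ (Qs *ᵥ ψ))

/-- (2.23) IS the part I translation (I.3.10)/(I.3.18) `…B1Sect3Statements.transl310` (*"almost identical to V^{(0)} in
Chap. I.3, only with the modified propagators"*) with the conditioned covariance. [cite: Balaban1982Higgs2, (2.23) p.561] -/
theorem transl223_eq_transl310 [Fintype X] [Fintype Y] (c : ℝ) (CΛ : Matrix X X ℝ) (Qs : Matrix X Y ℝ)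
    (φ' : X → ℝ) (ψ : Y → ℝ) :
    transl223 c CΛ Qs φ' ψ = B1Sect3Statements.transl310 c CΛ.mulVecLin Qs.mulVecLin φ' ψ := by
  simp [transl223, B1Sect3Statements.transl310]

/-- *"the similar formula holds for the vector field"*: with the plain adjoint averaging `Q*` (kernel `qstar w blk`) the
shape (2.23) is literally the vector-field translation (2.18) `…B2Eq218Translation.transl218`.
[cite: Balaban1982Higgs2, (2.18) p.560, (2.23) p.561] -/
theorem transl223_qstar [Fintype X] [Fintype Y] [DecidableEq Y] (c w : ℝ) (CΛ : Matrix X X ℝ) (blk : X → Y)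
    (A' : X → ℝ) (B : Y → ℝ) : transl223 c CΛ (qstar w blk) A' B = transl218 c w CΛ blk A' B := rfl

/-- (2.23) at a point: `φ(x) = φ′(x) + aL⁻² Σ_{x′} C^{(0)}_{Λ₃}(x, x′)(Q*ψ)(x′)`. [cite: Balaban1982Higgs2, (2.23) p.561] -/
theorem transl223_apply [Fintype X] [Fintype Y] (c : ℝ) (CΛ : Matrix X X ℝ) (Qs : Matrix X Y ℝ) (φ' : X → ℝ)
    (ψ : Y → ℝ) (x : X) : transl223 c CΛ Qs φ' ψ x = φ' x + c * (CΛ *ᵥ (Qs *ᵥ ψ)) x := rfl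

/-! ## §3  (2.27), (I.2.31)–(I.2.32), the one-pair Gaussian exponent and the boundary sum of (2.26) -/

/-- `(C^{(k)})⁻¹ = aL⁻²P(A) + Δ^{(k)}(Ω,A)` of (I.2.31), `P(A) = Q*(A)Q(A)`: the precision operator of the effective
integration, `c` ↤ `aL⁻²`, `D` ↤ `Δ^{(k)}(Ω,A)` (at `k = 0`: `−Δ_A + m²ε²`, resp. `−Δ + μ₀²ε²`); its compression to `Λ` is
inverted by `C^{(k)}_Λ(Ω,A)` (I.2.32). [cite: Balaban1982Higgs1, (2.31)–(2.32) p.611] -/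
def kOp [Fintype X] [Fintype Y] (c : ℝ) (Q : Matrix Y X ℝ) (Qs : Matrix X Y ℝ) (D : Matrix X X ℝ) : Matrix X X ℝ :=
  c • (Qs * Q) + D

/-- **(2.27)** p. 562 [PDF 8] as an operator on block fields: `Δ^{(k+1),L}_Λ(Ω,A) = aL⁻²χ_{Λ′} − a²L⁻⁴Q(A)C^{(k)}_Λ(Ω,A)Q*(A)`,
whose quadratic form in `⟨·,·⟩_{T′₁}` is the printed right side (`form227`). [cite: Balaban1982Higgs2, (2.27) p.562] -/
def delta227 [Fintype X] [Fintype Y] [DecidableEq Y] (c : ℝ) (Λ' : Finset Y) (Q : Matrix Y X ℝ) (CΛ : Matrix X X ℝ)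
    (Qs : Matrix X Y ℝ) : Matrix Y Y ℝ :=
  c • Matrix.diagonal (fun y => if y ∈ Λ' then (1 : ℝ) else 0) - c ^ 2 • (Q * CΛ * Qs)

/-- **(2.27)** p. 562, verbatim: *"⟨ψ, Δ^{(k+1),L}_Λ(Ω, A)ψ⟩ = aL^{d−2} Σ_{y∈Λ′} |ψ(y)|² − a²L⁻⁴⟨ψ, Q(A)C^{(k)}_Λ(Ω, A)Q*(A)ψ⟩,
Λ ⊂ Ω^{(k)}"* — with `⟨ψ, Kψ⟩_{T′₁} = w·(ψ ⬝ᵥ Kψ)`, `c·w = aL^{d−2}`, `c²·w·(…) = a²L⁻⁴⟨…⟩_{T′₁}`.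
[cite: Balaban1982Higgs2, (2.27) p.562] -/
theorem form227 [Fintype X] [Fintype Y] [DecidableEq Y] (c w : ℝ) (Λ' : Finset Y) (Q : Matrix Y X ℝ)
    (CΛ : Matrix X X ℝ) (Qs : Matrix X Y ℝ) (ψ : Y → ℝ) :
    w * (ψ ⬝ᵥ (delta227 c Λ' Q CΛ Qs *ᵥ ψ)) =
      c * w * ∑ y ∈ Λ', ψ y ^ 2 - c ^ 2 * (w * (ψ ⬝ᵥ ((Q * CΛ * Qs) *ᵥ ψ))) := by
  have hdiag : ψ ⬝ᵥ (Matrix.diagonal (fun y => if y ∈ Λ' then (1 : ℝ) else 0) *ᵥ ψ) = ∑ y ∈ Λ', ψ y ^ 2 := by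
    simp only [dotProduct, Matrix.mulVec_diagonal]
    rw [← Fintype.sum_ite_mem Λ']
    exact Finset.sum_congr rfl fun y _ => by split_ifs <;> ring
  simp only [delta227, Matrix.sub_mulVec, Matrix.smul_mulVec, dotProduct_sub, dotProduct_smul, smul_eq_mul,
    hdiag]
  ring

/-- The one-pair Gaussian exponent of (2.1) p. 556 / (I.3.7) p. 613, verbatim (with its sign): *"−½aL^{d−2} Σ_{y∈T′₁} |ψ(y) −
(Q(A)φ)(y)|² − ½⟨φ, (−Δ_A + m²ε²)φ⟩"* (and the same for the pair `A, B` with `Q`, `−Δ + μ₀²ε²`) — typed as MINUS the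
exponent: `½·c·w·Σ_y (ψ(y) − (Qφ)(y))² + ½ φ ⬝ᵥ Dφ`. [cite: Balaban1982Higgs2, (2.1) p.556, (2.26) p.562] -/
noncomputable def gaussForm [Fintype X] [Fintype Y] (c w : ℝ) (Q : Matrix Y X ℝ) (D : Matrix X X ℝ) (φ : X → ℝ) (ψ : Y → ℝ) : ℝ :=
  1 / 2 * (c * w) * ∑ y, (ψ y - (Q *ᵥ φ) y) ^ 2 + 1 / 2 * (φ ⬝ᵥ (D *ᵥ φ))

/-- The boundary sum of (2.26) p. 562, verbatim: *"+ aL⁻² Σ_{b∈st(Λ₃)} φ′(b₊)·U(B̃^{(1)}_b)(C^{(0)}_{Λ₃}(B^{(1)})Q*(B^{(1)})ψ)(b₋)"*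
(resp. *"+ aL⁻² Σ_{b∈st(Λ₀)} A′(b₊)·(C^{(0)}_{Λ₀}Q*B)(b₋)"*): the pairs `x = b₊ ∉ Λ`, `x′ = b₋ ∈ Λ`, parallel transport
`U = −D x x′` (zero unless `b` is a bond). [cite: Balaban1982Higgs2, (2.26) p.562] -/
def bdry226 [Fintype X] [Fintype Y] [DecidableEq X] (c : ℝ) (Λ : Finset X) (D CΛ : Matrix X X ℝ)
    (Qs : Matrix X Y ℝ) (φ' : X → ℝ) (ψ : Y → ℝ) : ℝ :=
  c * ∑ x ∈ Λᶜ, ∑ x' ∈ Λ, φ' x * (-D x x') * (CΛ *ᵥ (Qs *ᵥ ψ)) x'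

/-! ## §4  The identity behind the quadratic-form lines of (2.26) -/

section Identity

variable [Fintype X] [Fintype Y] [DecidableEq X] [DecidableEq Y]
  {c w : ℝ} {Λ : Finset X} {Λ' : Finset Y} {Q : Matrix Y X ℝ} {Qs : Matrix X Y ℝ} {D CΛ K : Matrix X X ℝ}

omit [DecidableEq X] [DecidableEq Y] in
/-- `Q* = L^d·Qᵀ` is the adjoint of `Q` for the scalar products of weight `1` on `T₁` and `L^d` on `T′₁`:
`⟨Q*u, v⟩_{T₁} = ⟨u, Qv⟩_{T′₁}`. [cite: Balaban1982Higgs2, (2.27) p.562] -/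
theorem adj_dot (hQs : Qs = w • Qᵀ) (u : Y → ℝ) (v : X → ℝ) : (Qs *ᵥ u) ⬝ᵥ v = w * (u ⬝ᵥ (Q *ᵥ v)) := by
  rw [hQs, Matrix.smul_mulVec, Matrix.mulVec_transpose, smul_dotProduct, smul_eq_mul, Matrix.dotProduct_mulVec]

omit [Fintype Y] [DecidableEq X] [DecidableEq Y] in
/-- A symmetric operator has a symmetric form: `⟨u, Kv⟩ = ⟨v, Ku⟩` (for `−Δ_A + m²ε²`, and for `aL⁻²P(A) + Δ^{(k)}`).
[cite: Balaban1982Higgs1, (2.31) p.611] -/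
theorem dot_mulVec_comm (hK : Kᵀ = K) (u v : X → ℝ) : u ⬝ᵥ (K *ᵥ v) = v ⬝ᵥ (K *ᵥ u) := by
  rw [Matrix.dotProduct_mulVec, ← Matrix.mulVec_transpose, hK, dotProduct_comm]

omit [DecidableEq X] [DecidableEq Y] in
/-- `P(A) = Q*(A)Q(A)` is symmetric (hence so is `aL⁻²P(A) + Δ^{(k)}` for symmetric `Δ^{(k)}`).
[cite: Balaban1982Higgs1, (2.31) p.611] -/
theorem kOp_transpose (hQs : Qs = w • Qᵀ) (hD : Dᵀ = D) : (kOp c Q Qs D)ᵀ = kOp c Q Qs D := by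
  rw [kOp, Matrix.transpose_add, Matrix.transpose_smul, Matrix.transpose_mul, hD, hQs, Matrix.transpose_smul,
    Matrix.transpose_transpose, Matrix.smul_mul, Matrix.mul_smul]

omit [Fintype Y] [DecidableEq X] [DecidableEq Y] in
/-- Dirichlet support of the conditioned covariance (I.2.32): `C^{(k)}_Λ u` vanishes off `Λ`.
[cite: Balaban1982Higgs1, (2.32) p.611] -/
theorem covΛ_mulVec_eq_zero (hCs : ∀ x x', CΛ x x' ≠ 0 → x ∈ Λ ∧ x' ∈ Λ) {x : X} (hx : x ∉ Λ) (u : X → ℝ) :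
    (CΛ *ᵥ u) x = 0 := by
  change ∑ x', CΛ x x' * u x' = 0
  refine Finset.sum_eq_zero fun x' _ => ?_
  by_cases h : CΛ x x' = 0
  · rw [h, zero_mul]
  · exact absurd (hCs x x' h).1 hx

omit [Fintype Y] [DecidableEq Y] in
/-- **(I.2.32) as used**: `C^{(k)}_Λ = ((aL⁻²P + Δ^{(k)})↾_Λ)⁻¹` means `(K·C^{(k)}_Λ u)(x) = u(x)` for `x ∈ Λ`, for every `u`.
[cite: Balaban1982Higgs1, (2.32) p.611] -/
theorem kOp_covΛ_mulVec (hCs : ∀ x x', CΛ x x' ≠ 0 → x ∈ Λ ∧ x' ∈ Λ)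
    (hC : ∀ x ∈ Λ, ∀ x' ∈ Λ, ∑ z, K x z * CΛ z x' = if x = x' then 1 else 0) {x : X} (hx : x ∈ Λ) (u : X → ℝ) :
    (K *ᵥ (CΛ *ᵥ u)) x = u x := by
  rw [Matrix.mulVec_mulVec]
  change ∑ x', (K * CΛ) x x' * u x' = u x
  have h : ∀ x', (K * CΛ) x x' * u x' = if x = x' then u x' else 0 := by
    intro x'
    rw [Matrix.mul_apply]
    by_cases hx' : x' ∈ Λ
    · rw [hC x hx x' hx']; split_ifs <;> simp
    · have h0 : ∑ z, K x z * CΛ z x' = 0 := Finset.sum_eq_zero fun z _ => by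
        by_cases h : CΛ z x' = 0
        · rw [h, mul_zero]
        · exact absurd (hCs z x' h).2 hx'
      have hne : x ≠ x' := fun h => hx' (h ▸ hx)
      rw [h0, zero_mul, if_neg hne]
  rw [Finset.sum_congr rfl fun x' _ => h x', Finset.sum_ite_eq]
  simp

omit [DecidableEq X] [DecidableEq Y] in
/-- *"the set Λ is a union of big blocks"*: for a field `v` supported in `Λ`, `P(A)v = Q*Qv` is again supported in `Λ`.
[cite: Balaban1982Higgs1, (2.32) p.611] -/
theorem QsQ_mulVec_eq_zero (hQs : Qs = w • Qᵀ) (hQ : ∀ y x, Q y x ≠ 0 → (x ∈ Λ ↔ y ∈ Λ')) {v : X → ℝ}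
    (hv : ∀ x ∉ Λ, v x = 0) {x : X} (hx : x ∉ Λ) : ((Qs * Q) *ᵥ v) x = 0 := by
  rw [← Matrix.mulVec_mulVec]
  change ∑ y, Qs x y * (Q *ᵥ v) y = 0
  refine Finset.sum_eq_zero fun y _ => ?_
  by_cases hq : Q y x = 0
  · simp [hQs, hq]
  · have hy : y ∉ Λ' := fun hy => hx ((hQ y x hq).2 hy)
    have h0 : (Q *ᵥ v) y = 0 := by
      change ∑ x', Q y x' * v x' = 0
      refine Finset.sum_eq_zero fun x' _ => ?_
      by_cases hq' : Q y x' = 0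
      · rw [hq', zero_mul]
      · rw [hv x' (fun hx' => hy ((hQ y x' hq').1 hx')), mul_zero]
    rw [h0, mul_zero]

/-- Block structure: `Σ_{x∈Λ} φ′(x)(Q*ψ)(x) = L^d Σ_{y∈Λ′} ψ(y)(Qφ′)(y)` — the `Λ`-part of `⟨φ′, Q*ψ⟩` only sees `ψ` on the
block set `Λ′`. [cite: Balaban1982Higgs2, (2.26)–(2.27) p.562] -/
theorem sum_mul_Qs_mulVec (hQs : Qs = w • Qᵀ) (hQ : ∀ y x, Q y x ≠ 0 → (x ∈ Λ ↔ y ∈ Λ')) (φ' : X → ℝ)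
    (ψ : Y → ℝ) : ∑ x ∈ Λ, φ' x * (Qs *ᵥ ψ) x = w * ∑ y ∈ Λ', ψ y * (Q *ᵥ φ') y := by
  have key : ∀ x y, (if x ∈ Λ then w * Q y x * φ' x * ψ y else 0) =
      (if y ∈ Λ' then w * Q y x * φ' x * ψ y else 0) := by
    intro x y
    by_cases hq : Q y x = 0
    · simp [hq]
    · by_cases hx : x ∈ Λ
      · rw [if_pos hx, if_pos ((hQ y x hq).1 hx)]
      · rw [if_neg hx, if_neg (fun hy => hx ((hQ y x hq).2 hy))]
  have hL : ∑ x ∈ Λ, φ' x * (Qs *ᵥ ψ) x = ∑ x, ∑ y, if x ∈ Λ then w * Q y x * φ' x * ψ y else 0 := by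
    have h1 : ∀ x, (∑ y, if x ∈ Λ then w * Q y x * φ' x * ψ y else 0) =
        if x ∈ Λ then φ' x * (Qs *ᵥ ψ) x else 0 := by
      intro x
      by_cases hx : x ∈ Λ
      · simp only [if_pos hx]
        change _ = φ' x * ∑ y, Qs x y * ψ y
        rw [hQs, Finset.mul_sum]
        exact Finset.sum_congr rfl fun y _ => by
          simp only [Matrix.smul_apply, Matrix.transpose_apply, smul_eq_mul]; ring
      · simp only [if_neg hx, Finset.sum_const_zero]
    rw [Finset.sum_congr rfl fun x _ => h1 x, Fintype.sum_ite_mem]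
  have hR : w * ∑ y ∈ Λ', ψ y * (Q *ᵥ φ') y = ∑ x, ∑ y, if y ∈ Λ' then w * Q y x * φ' x * ψ y else 0 := by
    rw [Finset.sum_comm]
    have h1 : ∀ y, (∑ x, if y ∈ Λ' then w * Q y x * φ' x * ψ y else 0) =
        if y ∈ Λ' then w * (ψ y * (Q *ᵥ φ') y) else 0 := by
      intro y
      by_cases hy : y ∈ Λ'
      · simp only [if_pos hy]
        change _ = w * (ψ y * ∑ x, Q y x * φ' x)
        rw [Finset.mul_sum, Finset.mul_sum]
        exact Finset.sum_congr rfl fun x _ => by ring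
      · simp only [if_neg hy, Finset.sum_const_zero]
    rw [Finset.sum_congr rfl fun y _ => h1 y, Fintype.sum_ite_mem, Finset.mul_sum]
  rw [hL, hR]
  exact Finset.sum_congr rfl fun x _ => Finset.sum_congr rfl fun y _ => key x y

omit [Fintype Y] [DecidableEq Y] in
/-- The conditioned covariance (I.2.32) sees the precision operator only through its `Λ × Λ` block: if `K` and `K′` agree on
`Λ × Λ`, every `C_Λ` for `K` is one for `K′` — why (2.25)/(2.26) may write `C^{(0)}_{Λ₃}(B^{(1)})`, `Q*(B^{(1)})` inside the
Λ₃-localized terms although the fields are `B̃^{(1)}` (`B̃^{(1)} = B^{(1)}` on `Λ₂ ⊃ Λ₃`, `btilde_eq_bOne_of_theta_eq_one`).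
[cite: Balaban1982Higgs1, (2.32) p.611] [cite: Balaban1982Higgs2, (2.25) p.562] -/
theorem inv232_congr {K' : Matrix X X ℝ} (hCs : ∀ x x', CΛ x x' ≠ 0 → x ∈ Λ ∧ x' ∈ Λ)
    (hKK' : ∀ x ∈ Λ, ∀ z ∈ Λ, K x z = K' x z)
    (hC : ∀ x ∈ Λ, ∀ x' ∈ Λ, ∑ z, K x z * CΛ z x' = if x = x' then 1 else 0) :
    ∀ x ∈ Λ, ∀ x' ∈ Λ, ∑ z, K' x z * CΛ z x' = if x = x' then 1 else 0 := by
  intro x hx x' hx'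
  rw [← hC x hx x' hx']
  refine Finset.sum_congr rfl fun z _ => ?_
  by_cases h : CΛ z x' = 0
  · rw [h, mul_zero, mul_zero]
  · rw [hKK' x hx z (hCs z x' h).1]

/-- **The quadratic-form lines of (2.26)** p. 562 from the translation (2.18)/(2.23), PROVED: for the one-pair exponent
`½aL^{d−2}Σ_y |ψ(y) − (Qφ)(y)|² + ½⟨φ, Dφ⟩` (`gaussForm`), `Q* = L^dQᵀ` (`hQs`), `D` symmetric (`hD`), `Λ` a union of
big blocks with block set `Λ′` (`hQ`) and `C_Λ = ((aL⁻²Q*Q + D)↾_Λ)⁻¹` extended by zero ((I.2.32): `hCs`, `hC`), the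
substitution `φ = φ′ + aL⁻²C_ΛQ*ψ` gives EXACTLY
`½aL^{d−2}Σ_y |(Λ′ᶜψ)(y) − (Qφ′)(y)|² + ½⟨φ′, Dφ′⟩ − aL⁻²Σ_{st(Λ)} φ′(b₊)·(−D_{b₊b₋})(C_ΛQ*ψ)(b₋) + ½⟨ψ, Δ^{(k+1),L}_Λψ⟩`
with `Δ^{(k+1),L}_Λ` given by (2.27) — i.e. minus lines 1–2 (pair `A′, B`, `Λ = Λ₀`) and minus lines 3–5 (pair `φ′, ψ`,
`Λ = Λ₃`) of the exponent in (2.26). [cite: Balaban1982Higgs2, (2.26)–(2.27) p.562] -/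
theorem eq226_quadratic (hQs : Qs = w • Qᵀ) (hQ : ∀ y x, Q y x ≠ 0 → (x ∈ Λ ↔ y ∈ Λ')) (hD : Dᵀ = D)
    (hCs : ∀ x x', CΛ x x' ≠ 0 → x ∈ Λ ∧ x' ∈ Λ)
    (hC : ∀ x ∈ Λ, ∀ x' ∈ Λ, ∑ z, kOp c Q Qs D x z * CΛ z x' = if x = x' then 1 else 0)
    (φ' : X → ℝ) (ψ : Y → ℝ) :
    gaussForm c w Q D (transl223 c CΛ Qs φ' ψ) ψ =
      1 / 2 * (c * w) * ∑ y, ((ψ - B2Eq218Translation.restrict Λ' ψ) y - (Q *ᵥ φ') y) ^ 2 + 1 / 2 * (φ' ⬝ᵥ (D *ᵥ φ'))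
        - bdry226 c Λ D CΛ Qs φ' ψ + 1 / 2 * (w * (ψ ⬝ᵥ (delta227 c Λ' Q CΛ Qs *ᵥ ψ))) := by
  -- names: `u = Q*ψ`, `φ₀ = aL⁻²C_ΛQ*ψ`, `K = aL⁻²Q*Q + D`, and the four sums
  obtain ⟨u, hu⟩ : ∃ u : X → ℝ, u = Qs *ᵥ ψ := ⟨_, rfl⟩
  obtain ⟨φ₀, hφ₀⟩ : ∃ φ₀ : X → ℝ, φ₀ = c • (CΛ *ᵥ u) := ⟨_, rfl⟩
  obtain ⟨K, hK⟩ : ∃ K : Matrix X X ℝ, K = kOp c Q Qs D := ⟨_, rfl⟩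
  obtain ⟨S0, hS0⟩ : ∃ S0 : ℝ, S0 = ∑ y, (ψ y - (Q *ᵥ φ') y) ^ 2 := ⟨_, rfl⟩
  obtain ⟨S1, hS1⟩ : ∃ S1 : ℝ, S1 = ∑ y, ((ψ - B2Eq218Translation.restrict Λ' ψ) y - (Q *ᵥ φ') y) ^ 2 := ⟨_, rfl⟩
  obtain ⟨S2, hS2⟩ : ∃ S2 : ℝ, S2 = ∑ y ∈ Λ', ψ y ^ 2 := ⟨_, rfl⟩
  obtain ⟨T, hT⟩ : ∃ T : ℝ, T = ∑ y ∈ Λ', ψ y * (Q *ᵥ φ') y := ⟨_, rfl⟩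
  rw [← hS1]
  have htr : transl223 c CΛ Qs φ' ψ = φ' + φ₀ := by rw [transl223, hφ₀, hu]
  rw [htr]
  -- support and inversion facts
  have hout : ∀ x ∉ Λ, φ₀ x = 0 := fun x hx => by
    rw [hφ₀, Pi.smul_apply, smul_eq_mul, covΛ_mulVec_eq_zero hCs hx, mul_zero]
  have hKin : ∀ x ∈ Λ, (K *ᵥ φ₀) x = c * u x := fun x hx => by
    rw [hφ₀, Matrix.mulVec_smul, Pi.smul_apply, smul_eq_mul, hK, kOp_covΛ_mulVec hCs hC hx]
  have hKout : ∀ x ∉ Λ, (K *ᵥ φ₀) x = (D *ᵥ φ₀) x := fun x hx => by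
    rw [hK, kOp, Matrix.add_mulVec, Pi.add_apply, Matrix.smul_mulVec, Pi.smul_apply,
      QsQ_mulVec_eq_zero hQs hQ hout hx, smul_zero, zero_add]
  have hKT : Kᵀ = K := by rw [hK]; exact kOp_transpose hQs hD
  -- Step A: expansion of the form at `φ′ + φ₀`
  have hA : gaussForm c w Q D (φ' + φ₀) ψ = 1 / 2 * (c * w) * S0
      - (c * w) * ((ψ - Q *ᵥ φ') ⬝ᵥ (Q *ᵥ φ₀)) + 1 / 2 * (c * w) * ((Q *ᵥ φ₀) ⬝ᵥ (Q *ᵥ φ₀))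
      + 1 / 2 * (φ' ⬝ᵥ (D *ᵥ φ')) + φ' ⬝ᵥ (D *ᵥ φ₀) + 1 / 2 * (φ₀ ⬝ᵥ (D *ᵥ φ₀)) := by
    have hS : ∑ y, (ψ y - (Q *ᵥ (φ' + φ₀)) y) ^ 2 =
        S0 - 2 * ((ψ - Q *ᵥ φ') ⬝ᵥ (Q *ᵥ φ₀)) + (Q *ᵥ φ₀) ⬝ᵥ (Q *ᵥ φ₀) := by
      rw [hS0]
      simp only [dotProduct, Matrix.mulVec_add, Pi.add_apply, Pi.sub_apply]
      rw [Finset.mul_sum, ← Finset.sum_sub_distrib, ← Finset.sum_add_distrib]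
      exact Finset.sum_congr rfl fun y _ => by ring
    have hDD : (φ' + φ₀) ⬝ᵥ (D *ᵥ (φ' + φ₀)) =
        φ' ⬝ᵥ (D *ᵥ φ') + 2 * (φ' ⬝ᵥ (D *ᵥ φ₀)) + φ₀ ⬝ᵥ (D *ᵥ φ₀) := by
      rw [Matrix.mulVec_add, dotProduct_add, add_dotProduct, add_dotProduct, dot_mulVec_comm hD φ₀ φ']; ring
    unfold gaussForm
    rw [hS, hDD]; ring
  -- the individual rewritings
  have h1 : w * ((ψ - Q *ᵥ φ') ⬝ᵥ (Q *ᵥ φ₀)) = u ⬝ᵥ φ₀ - ((Qs * Q) *ᵥ φ') ⬝ᵥ φ₀ := by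
    rw [← adj_dot hQs, Matrix.mulVec_sub, sub_dotProduct, ← hu, Matrix.mulVec_mulVec]
  have h2 : w * ((Q *ᵥ φ₀) ⬝ᵥ (Q *ᵥ φ₀)) = ((Qs * Q) *ᵥ φ₀) ⬝ᵥ φ₀ := by
    rw [← adj_dot hQs, Matrix.mulVec_mulVec]
  have h3 : φ₀ ⬝ᵥ (K *ᵥ φ₀) = c * (((Qs * Q) *ᵥ φ₀) ⬝ᵥ φ₀) + φ₀ ⬝ᵥ (D *ᵥ φ₀) := by
    rw [hK, kOp, Matrix.add_mulVec, Matrix.smul_mulVec, dotProduct_add, dotProduct_smul, smul_eq_mul,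
      dotProduct_comm φ₀ ((Qs * Q) *ᵥ φ₀)]
  have h4 : φ₀ ⬝ᵥ (K *ᵥ φ₀) = c * (u ⬝ᵥ φ₀) := by
    simp only [dotProduct, Finset.mul_sum]
    refine Finset.sum_congr rfl fun x _ => ?_
    by_cases hx : x ∈ Λ
    · rw [hKin x hx]; ring
    · rw [hout x hx]; ring
  have h5 : φ' ⬝ᵥ (K *ᵥ φ₀) = c * (((Qs * Q) *ᵥ φ') ⬝ᵥ φ₀) + φ' ⬝ᵥ (D *ᵥ φ₀) := by
    have hP : (Qs * Q)ᵀ = Qs * Q := by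
      rw [hQs, Matrix.smul_mul, Matrix.transpose_smul, Matrix.transpose_mul, Matrix.transpose_transpose]
    rw [hK, kOp, Matrix.add_mulVec, Matrix.smul_mulVec, dotProduct_add, dotProduct_smul, smul_eq_mul,
      dot_mulVec_comm hP φ' φ₀, dotProduct_comm φ₀ ((Qs * Q) *ᵥ φ')]
  have h6 : φ' ⬝ᵥ (K *ᵥ φ₀) = c * (∑ x ∈ Λ, φ' x * u x) + ∑ x ∈ Λᶜ, φ' x * (D *ᵥ φ₀) x := by
    rw [dotProduct, ← Finset.sum_add_sum_compl Λ, Finset.mul_sum]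
    congr 1
    · exact Finset.sum_congr rfl fun x hx => by rw [hKin x hx]; ring
    · exact Finset.sum_congr rfl fun x hx => by rw [hKout x (Finset.mem_compl.mp hx)]
  have h7 : ∑ x ∈ Λ, φ' x * u x = w * T := by rw [hu, hT]; exact sum_mul_Qs_mulVec hQs hQ φ' ψ
  have h8 : ∑ x ∈ Λᶜ, φ' x * (D *ᵥ φ₀) x = -bdry226 c Λ D CΛ Qs φ' ψ := by
    rw [bdry226, ← hu, Finset.mul_sum, ← Finset.sum_neg_distrib]
    refine Finset.sum_congr rfl fun x _ => ?_
    have hDφ₀ : (D *ᵥ φ₀) x = c * ∑ x' ∈ Λ, D x x' * (CΛ *ᵥ u) x' := by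
      rw [hφ₀, Matrix.mulVec_smul, Pi.smul_apply, smul_eq_mul]
      congr 1
      change ∑ x', D x x' * (CΛ *ᵥ u) x' = _
      rw [← Finset.sum_add_sum_compl Λ, add_eq_left]
      exact Finset.sum_eq_zero fun x' hx' => by
        rw [covΛ_mulVec_eq_zero hCs (Finset.mem_compl.mp hx') u, mul_zero]
    rw [hDφ₀, Finset.mul_sum, Finset.mul_sum, Finset.mul_sum, ← Finset.sum_neg_distrib]
    exact Finset.sum_congr rfl fun x' _ => by ring
  have h9 : u ⬝ᵥ φ₀ = c * (u ⬝ᵥ (CΛ *ᵥ u)) := by rw [hφ₀, dotProduct_smul, smul_eq_mul]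
  have h10 : w * (ψ ⬝ᵥ ((Q * CΛ * Qs) *ᵥ ψ)) = u ⬝ᵥ (CΛ *ᵥ u) := by
    rw [Matrix.mul_assoc, ← Matrix.mulVec_mulVec, ← adj_dot hQs, ← Matrix.mulVec_mulVec, ← hu]
  have hform : w * (ψ ⬝ᵥ (delta227 c Λ' Q CΛ Qs *ᵥ ψ)) = c * w * S2 - c ^ 2 * (w * (ψ ⬝ᵥ ((Q * CΛ * Qs) *ᵥ ψ))) := by
    rw [hS2]; exact form227 c w Λ' Q CΛ Qs ψ
  -- completing the square in the block variable: `Σ(ψ − Qφ′)² + 2Σ_{Λ′}ψ·Qφ′ = Σ(Λ′ᶜψ − Qφ′)² + Σ_{Λ′}ψ²`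
  have hsq : S0 + 2 * T = S1 + S2 := by
    have hT' : T = ∑ y, if y ∈ Λ' then ψ y * (Q *ᵥ φ') y else 0 := by
      rw [hT, Fintype.sum_ite_mem]
    have hS2' : S2 = ∑ y, if y ∈ Λ' then ψ y ^ 2 else 0 := by
      rw [hS2, Fintype.sum_ite_mem]
    rw [hS0, hS1, hT', hS2', Finset.mul_sum, ← Finset.sum_add_distrib, ← Finset.sum_add_distrib]
    refine Finset.sum_congr rfl fun y _ => ?_
    rw [sub_restrict_apply]
    split_ifs <;> ring
  linear_combination hA - c * h1 + (1 / 2 * c) * h2 - (1 / 2) * h3 + (1 / 2) * h4 - h5 + h6 + c * h7 + h8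
    + (1 / 2 * (c * w)) * hsq - (1 / 2 * c) * h9 - (1 / 2) * hform + (1 / 2 * c ^ 2) * h10

/-- **(2.26), its quadratic-form lines with the printed signs**: the exponent `−gaussForm` after the translation equals
`−½aL^{d−2}Σ_y |(Λ′ᶜψ)(y) − (Qφ′)(y)|² − ½⟨φ′, Dφ′⟩ + aL⁻²Σ_{b∈st(Λ)} φ′(b₊)·U(b)(C_ΛQ*ψ)(b₋) − ½⟨ψ, Δ^{(k+1),L}_Λψ⟩`.
[cite: Balaban1982Higgs2, (2.26) p.562] -/
theorem eq226_lines (hQs : Qs = w • Qᵀ) (hQ : ∀ y x, Q y x ≠ 0 → (x ∈ Λ ↔ y ∈ Λ')) (hD : Dᵀ = D)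
    (hCs : ∀ x x', CΛ x x' ≠ 0 → x ∈ Λ ∧ x' ∈ Λ)
    (hC : ∀ x ∈ Λ, ∀ x' ∈ Λ, ∑ z, kOp c Q Qs D x z * CΛ z x' = if x = x' then 1 else 0)
    (φ' : X → ℝ) (ψ : Y → ℝ) :
    -gaussForm c w Q D (transl223 c CΛ Qs φ' ψ) ψ =
      -(1 / 2 * (c * w) * ∑ y, ((ψ - B2Eq218Translation.restrict Λ' ψ) y - (Q *ᵥ φ') y) ^ 2) - 1 / 2 * (φ' ⬝ᵥ (D *ᵥ φ'))
        + bdry226 c Λ D CΛ Qs φ' ψ - 1 / 2 * (w * (ψ ⬝ᵥ (delta227 c Λ' Q CΛ Qs *ᵥ ψ))) := by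
  rw [eq226_quadratic hQs hQ hD hCs hC]; ring

/-- The whole-lattice case (`Λ = T₁`, `Λ′ = T′₁`: no conditioning, `C = (aL⁻²Q*Q + D)⁻¹` as in (I.2.31)): no boundary term
and `Λ′ᶜψ = 0`, so the translated form is `½(aL^{d−2}Σ_y |(Qφ′)(y)|² + ⟨φ′, Dφ′⟩) + ½⟨ψ, Δ^{(k+1),L}ψ⟩` — the first
equality of (I.3.11) p. 614 / (I.3.19) p. 615 (cf. `…B1Eq314Proof.split311_matrix`).
[cite: Balaban1982Higgs1, (3.11) p.614] [cite: Balaban1982Higgs2, (2.26)–(2.27) p.562] -/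
theorem eq226_quadratic_univ {C : Matrix X X ℝ} (hQs : Qs = w • Qᵀ) (hD : Dᵀ = D) (hC : kOp c Q Qs D * C = 1)
    (φ' : X → ℝ) (ψ : Y → ℝ) :
    gaussForm c w Q D (transl223 c C Qs φ' ψ) ψ =
      1 / 2 * ((c * w) * ∑ y, (Q *ᵥ φ') y ^ 2 + φ' ⬝ᵥ (D *ᵥ φ'))
        + 1 / 2 * (w * (ψ ⬝ᵥ (delta227 c Finset.univ Q C Qs *ᵥ ψ))) := by
  have h := eq226_quadratic (Λ := Finset.univ) (Λ' := Finset.univ) (CΛ := C) hQs (fun _ _ _ => by simp) hD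
    (fun _ _ _ => by simp) (fun x _ x' _ => by
      rw [← Matrix.mul_apply, hC, Matrix.one_apply]) φ' ψ
  have hb : bdry226 c Finset.univ D C Qs φ' ψ = 0 := by
    rw [bdry226, Finset.sum_eq_zero (fun x hx => absurd (Finset.mem_univ x) (Finset.mem_compl.mp hx)), mul_zero]
  have hr : ∀ y, (ψ - B2Eq218Translation.restrict Finset.univ ψ) y = 0 := fun y => by
    rw [sub_restrict_apply, if_pos (Finset.mem_univ y)]
  rw [h, hb]
  simp only [hr, zero_sub, neg_sq]
  ring

end Identity

/-! ## §5 (v1.1)  (2.35) p. 564, and the field `ψ^{(1)}` of (2.25) -/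

/-- **(2.35)** p. 564 [PDF 10], verbatim: *"Because the first representation on the right side above was obtained by doing
the translations in the fields A′, φ′ inverse to (2.18), (2.23), we have  B̃^{(1)} = (1 − θ₁)A + θ₁B^{(1)}, (2.35)"* — with
`A` the translated field (2.18) (`…B2Eq218Translation.transl218`) and `B^{(1)}` the configuration (2.24) (`bOne`): PROVED
(as functions on `T₁`; pointwise it is §1's `btilde_eq_transl218_bOne`, read off the bracket of (2.19)).
[cite: Balaban1982Higgs2, (2.35) p.564] -/
theorem eq235 [Fintype X] [Fintype Y] [DecidableEq Y] (c w : ℝ) (CΛ C : Matrix X X ℝ) (blk : X → Y) (θ : X → ℝ)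
    (ζ : Matrix X Y ℝ) (A' : X → ℝ) (B : Y → ℝ) :
    btilde c w CΛ C blk θ ζ A' B =
      fun x => (1 - θ x) * transl218 c w CΛ blk A' B x + θ x * bOne c w C blk ζ B x :=
  funext fun x => btilde_eq_transl218_bOne c w CΛ C blk θ ζ A' B x

/-- **`ψ^{(1)}`** of (2.25) p. 562 [PDF 8], verbatim: *"aL⁻²(C^{(0)}_{Λ₃}(B̃^{(1)})Q*(B̃^{(1)})ψ)(x) = aL⁻²(G₁(Λ₂, B^{(1)})
Q*(B^{(1)})Λ₆ψ)(x) + O(ε^κ) =: ψ^{(1)}(x) + O(ε^κ), κ > d, x ∈ Λ₇"* — the DEFINED field `ψ^{(1)} = aL⁻²G₁(Λ₂, B^{(1)})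
Q*(B^{(1)})Λ₆ψ`: `c` ↤ `aL⁻²`, `G1` ↤ `G₁(Λ₂, B^{(1)})` (the propagator of Proposition I.2), `Qs` ↤ `Q*(B^{(1)})`, `Λ₆ψ` =
`restrict Λ₆′ ψ`; the analogue of part I's `ψ^{(1)}` of (I.3.18).  The `O(ε^κ)` replacement asserted by (2.25) (Proposition
I.2 + Lemma 2.3) is an estimate and is NOT stated here. [cite: Balaban1982Higgs2, (2.25) p.562] -/
def psiOne [Fintype X] [Fintype Y] [DecidableEq Y] (c : ℝ) (G1 : Matrix X X ℝ) (Qs : Matrix X Y ℝ) (Λ₆' : Finset Y)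
    (ψ : Y → ℝ) : X → ℝ :=
  c • (G1 *ᵥ (Qs *ᵥ B2Eq218Translation.restrict Λ₆' ψ))

/-- `ψ^{(1)}` is the shift part of the translation shape (2.23), taken with `G₁(Λ₂, B^{(1)})` and the restricted block field
`Λ₆ψ`: `ψ^{(1)} = transl223 (aL⁻²) G₁ Q* 0 (Λ₆ψ)`. [cite: Balaban1982Higgs2, (2.23) p.561, (2.25) p.562] -/
theorem psiOne_eq_transl223 [Fintype X] [Fintype Y] [DecidableEq Y] (c : ℝ) (G1 : Matrix X X ℝ) (Qs : Matrix X Y ℝ)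
    (Λ₆' : Finset Y) (ψ : Y → ℝ) :
    psiOne c G1 Qs Λ₆' ψ = transl223 c G1 Qs 0 (B2Eq218Translation.restrict Λ₆' ψ) := by
  simp [psiOne, transl223]

/-- `ψ^{(1)}` at a point: `ψ^{(1)}(x) = aL⁻² Σ_{x′} G₁(x, x′)(Q*Λ₆ψ)(x′)`. [cite: Balaban1982Higgs2, (2.25) p.562] -/
theorem psiOne_apply [Fintype X] [Fintype Y] [DecidableEq Y] (c : ℝ) (G1 : Matrix X X ℝ) (Qs : Matrix X Y ℝ)
    (Λ₆' : Finset Y) (ψ : Y → ℝ) (x : X) :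
    psiOne c G1 Qs Λ₆' ψ x = c * (G1 *ᵥ (Qs *ᵥ B2Eq218Translation.restrict Λ₆' ψ)) x := rfl

end Literature.MathematicalPhysics.QuantumFieldTheory.Balaban1983to89.B2Eq224FirstStepFields
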